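import Summits.Langlands.Langlands.Theses.PicardMuOrdinary
import Summits.Langlands.Langlands.Theorems.PicardMuOrdinaryMuOrdinaryFamilyRTMod3nDefs
import Summits.Langlands.Langlands.Theorems.PicardMuOrdinaryMuOrdinaryFamilyRTLiePlaces
import Summits.Langlands.Langlands.Theorems.PicardMuOrdinaryMuOrdinaryFamilyRTLevelLowering
import Summits.Langlands.Langlands.Theorems.MuOrdinaryFamilyRT.Negative.ScopeVacuity
import Summits.Langlands.Langlands.Theorems.MuOrdinaryFamilyRT.Negative.AccumulationDominance
import Summits.Langlands.Langlands.Theorems.MuOrdinaryFamilyRT.Negative.AccumulationNormality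
import Summits.Langlands.Langlands.Theorems.MuOrdinaryFamilyRT.Negative.ConjSelfDualShadow
import Summits.Langlands.Langlands.Theorems.MuOrdinaryFamilyRT.Negative.ZariskiVsPadicDensity
import Summits.Langlands.Langlands.Theorems.MuOrdinaryFamilyRT.Negative.CongruenceEncoding
import HarnessLib

/-!
# Line `mod3n-successive-approximation` — skeleton (crux-plan, gen 1)
# for the crux `Summit.Langlands.Langlands.Theses.PicardMuOrdinary.MuOrdinaryFamilyRT` (stmt-Langlands-13757)

Idea card `Cruxes/MuOrdinaryFamilyRT/Ideas/mod3n-successive-approximation.md` (crux-ideate r1 k2; triage r1-2 PASS,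
r1-3 PASS with the K3 correction): Khare–Thorne / Thorne "automorphy modulo `3^N` by successive approximation" pointed at
the IRREGULAR weight.  For each `N`, `ρ_C mod 3^N` is shown automorphic of tame level `S₀ ∪ Y_N` by an `R_{𝒮_N} → 𝕋_{𝒮_N}`
theorem whose deformation problem `𝒮_N` imposes Khare–Thorne's Steinberg-shaped condition at `N`-DEPENDENT "Lie-killing"
places `Y_N` (Frobenius a 3-cycle of `S₄`, `N v ≡ 4, 7 mod 9`, `ρ_C(Frob_v)` exactly Steinberg-shaped mod `3^N`) — the device
that neutralises the Lie-type inadequacy of `A₄/S₄ ⊂ GL₃(𝔽₃)` at `p = 3` (K1, `S.stub_modNAutomorphy`); the auxiliary level is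
then removed by level-lowering mod `3^N` (K2, `S.stub_levelLowering`); the level-`S₀` approximate eigensystems for all `N` live
on ONE finite `Λ`-algebra — Hida's ordinary Hecke algebra of the definite `U(3)` attached to `K/ℚ` at the RAMIFIED quasi-split
prime `3` (after the CM twist `ψ` of conductor `3`, PARITY-NOTE / Disproof F13) — where compactness gives an honest `𝒪`-point over
the irregular weight and Hida finiteness + control give classical regular approximants of level `S` (K4 = the card's Transfer
`C⁺ ⇒ crux`, `S.stub_hidaLimitHost`); the typed congruence is then the LANDED accumulation (`stub_accumulation`, p85419) and
dictionary (`stub_dictionary`, p85480) of the `CharZeroDominance` namespace, natively over `K` (no quadratic descent).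

TYPING PRINCIPLE (what is new in this skeleton).  "`ρ_C` is automorphic mod `3^N` at level `(S₀; Y)`" is typed on the
GALOIS SIDE, with no Hecke algebra as an object: `AutomorphicMod hcpt ι N S₀ Y ρ_C` says that there are finitely many Galois
representations `ρ₁ … ρ_m`, each attached (lang.S27 compatibility, integral Satake) to a regular algebraic cuspidal `P_i` on
`GL₃(𝔸_K)` unramified outside `S₀ ∪ Y`, polarized, Borel at `λ` with a frame, of inertial level bounded by `ρ_C` inside `S₀`,
unipotent on inertia at `Y`, residually `≡ ρ̄_C`, such that the `𝒪_{ℚ̄₃}`-algebra they generate inside `∏_i ℚ̄₃` through their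
characteristic-polynomial tuples `(coeff_k det(X − ρ_i(σ)))_i` (traces, `T_{𝔭,2}`, determinants) and their ordered
diagonal-character tuples at `λ` admits an APPROXIMATE `𝒪`-ALGEBRA POINT of precision `3^{-N}` sending characteristic-polynomial
tuples to those of `ρ_C` and weight tuples to the diagonal characters of `ρ_C`.  Since the ordinary
Hecke algebra `𝕋^{ord}_κ(U^p U₀(Y), 𝒪)_𝔪 ⊗ ℚ̄₃` IS the product of the fields of its automorphic points and is generated over the
weight algebra by Frobenius traces, this is literally "an `𝒪/3^N`-valued point of `𝕋_𝔪` through `ρ_C mod 3^N`" (Thorne 2016,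
Def. before Thm 4.14), with the weight coordinates carried by the frames; every stub below is therefore an existential statement
about automorphic Galois representations, true iff the intended theorem holds, and no abstract "host" can be instantiated by junk.

SCOPE (answers Disproof F12 / triage): `Scope f ρ_C := IsMuOrdinaryAtThree ρ_C` (Galois side, landed, non-empty: `3x⁴+x³−54`,
F12b) `∧ HasExactSteinberg f ρ_C` (triage r1-2/r1-3 correction of K3: the image of `ρ_C` contains an EXACTLY Steinberg-shaped
element acting as a 3-cycle on the roots — a per-`f` group-theoretic condition living at level `λ²`, decided by a finite
computation; level-2 hit `p = 367` for `x⁴+x+1`, j011026).  `A₄` and `S₄` are treated alike (no discriminant clause).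
Outside the scope: the conceded `S.stub_remainder` (not a lemma of the line).

DISPROOF USED: F3 (the `P_k` come from accumulation at an honest `𝒪`-point, never from `hres`; the dictionary keeps the
`u ∉ 𝔐 ∧ u t ∈ (3^k)` encoding); F8 + `stub_accumulation_false_without_dominance` (p74393) + `…_without_normality` (p74844):
`S.stub_hidaLimitHost` must deliver `Module.Finite Λ R`, a normal Noetherian domain `Λ` and the dominance datum
`∃ 𝔮 prime ⊆ ker x, 𝔮 ∩ Λ = ⊥` (Hida: `𝕋^{ord}` is finite TORSION-FREE over `Λ`), exactly the hypotheses of the landed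
accumulation; F12 (scope is Galois-side); F13 / PARITY-NOTE (no conjugate self-duality is typed; `IsPolarized` is "up to a
character", the unitary-side objects are `ψ`-twists); `muOrdinaryFamilyRT_iff_remainder` does not bite (its scope predicate
`HasMuOrdinaryReductionAtThree f` is not used here).

RESHAPED by the lead prover-line-stmt-Langlands-13757-a1-0 (2026-08-16, v2): §§1–3 (vocabulary + the six `S.stub_*` statements) and
the glue `LiePlaceAt.mono` / `exists_finset_liePlaces` are LANDED as `Theorems/PicardMuOrdinaryMuOrdinaryFamilyRTMod3nDefs.lean`
(p117850) and imported; K3 `stub_liePlaces` is LANDED (`Theorems/…LiePlaces.lean`, p118456) and used below; the precision-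
monotonicity of `AutomorphicMod` and K2 at `Y = ∅` are LANDED (`Theorems/…LevelLowering.lean`, p118759).  Five sorries remain:
`stub_picardFact` (Literature debt `picardCurve_exists_lambdaAdicRep`), `stub_modNAutomorphy` (K1), `stub_levelLowering` (K2),
`stub_hidaLimitHost` (K4), `stub_remainder` (conceded complement) — statements unchanged.
-/

set_option linter.dupNamespace false

namespace Summit.Langlands.Langlands.Cruxes.MuOrdinaryFamilyRT.Mod3nSuccessiveApproximation

open scoped NumberField Polynomial Matrix Classical
open Field IsDedekindDomain Polynomial
open Literature.NumberTheory.GaloisRepresentations Literature.NumberTheory.Automorphic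
open Summit.Langlands.Langlands.Cruxes.MuOrdinaryFamilyRT.CharZeroDominance
  (K Generic PicardInput ResidualHyp LimitConcl crux_iff IsMuOrdinaryAtThree IsUpper3 Roots
    stub_picardInput_of stub_accumulation stub_dictionary instIsGaloisK)

noncomputable section

/-! ## 4. The registered stubs -/

/-- FACT STUB A (see `S.stub_picardFact`). -/
theorem stub_picardFact : S.stub_picardFact := by
  sorry

-- K3 `stub_liePlaces : S.stub_liePlaces` is LANDED (Theorems/PicardMuOrdinaryMuOrdinaryFamilyRTLiePlaces.lean, p118456).

/-- K1, THE LEVER (see `S.stub_modNAutomorphy`). -/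
theorem stub_modNAutomorphy : S.stub_modNAutomorphy := by
  sorry

/-- K2 (see `S.stub_levelLowering`). -/
theorem stub_levelLowering : S.stub_levelLowering := by
  sorry

/-- K4, the Transfer host (see `S.stub_hidaLimitHost`). -/
theorem stub_hidaLimitHost : S.stub_hidaLimitHost := by
  sorry

/-- The conceded complement (see `S.stub_remainder`). -/
theorem stub_remainder : S.stub_remainder := by
  sorry

/-! ## 5. The composition (glue `LiePlaceAt.mono`, `exists_finset_liePlaces` imported from the Defs file) -/

/-- **The line concludes the crux.**  For generic `f`: the Picard input `ρ_C` (FACT STUB A through the landed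
`stub_picardInput_of`); outside `Scope f ρ_C` the conceded `stub_remainder` (which alone consumes nothing but `hres`);
inside: K3 gives Lie-killing places mod `3^N` for every `N` (as many as K1 asks, `exists_finset_liePlaces`), K1 gives
automorphy mod `3^N` at level `(S₀; Y_N)`, K2 lowers the level to `(S₀; ∅)`, K4 turns the tower into an honest dominant point
`x` of a finite `Λ`-algebra with classical points over `D`; then the LANDED `stub_accumulation` (p85419) gives, for each `k`,
a classical `y_k` with `‖y_k − x‖ ≤ 3^{-k}` on `R`, hence `‖tr ρ_{y_k} − tr ρ_C‖ ≤ 3^{-k}` on `Γ_K`, and the LANDED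
`stub_dictionary` (p85480) converts compatibility + integrality into the typed `ℤ̄_𝔐`-congruence at every `𝔭 ∉ S ∪ S₀`. -/
theorem MuOrdinaryFamilyRT_of : S.stub_picardFact → S.stub_modNAutomorphy →
    S.stub_levelLowering → S.stub_hidaLimitHost → S.stub_remainder →
    Summit.Langlands.Langlands.Theses.PicardMuOrdinary.MuOrdinaryFamilyRT := by
  intro hA h₂ h₃ h₄ h₅
  have h₁ : S.stub_liePlaces := stub_liePlaces
  refine crux_iff.mpr ?_
  intro f hcpt hdeg hsep hgal hres
  have hgen : Generic f := ⟨hdeg, hsep, hgal⟩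
  -- FACT STUB A: the Picard representation and its Frobenius traces
  obtain ⟨ι, e, S₀, ρC, hin⟩ := stub_picardInput_of hA f hgen
  -- the scope: μ-ordinary at λ, an exact Steinberg element, unique root in ℚ₃; else the conceded remainder
  by_cases hsc : Scope f ρC
  swap
  · exact h₅ f hcpt ι e S₀ ρC hgen hin hsc hres
  -- K3: Lie-killing places modulo 3^N for every N
  have hLie : HasLiePlaces f ρC := h₁ f ι e S₀ ρC hgen hin hsc.2
  -- K1 + K2: automorphy modulo 3^N at level (S₀; ∅) for every N
  have hmod : ∀ N : ℕ, AutomorphicMod hcpt ι N S₀ ∅ ρC := by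
    intro N
    obtain ⟨r, c₂, hr⟩ := h₂ f hcpt ι e S₀ ρC hgen hin hsc hres
    obtain ⟨c₃, hc⟩ := h₃ f hcpt ι e S₀ ρC hgen hin hsc
    -- r Lie places modulo 3^(N + c₃ + c₂), disjoint from S₀
    obtain ⟨Y, hYcard, hYdisj, hYlie⟩ := exists_finset_liePlaces hLie (N + c₃ + c₂) r S₀
    have hYlie' : ∀ v ∈ Y, LiePlaceAt f ρC (N + c₃) v :=
      fun v hv => (hYlie v hv).mono (Nat.le_add_right _ _)
    exact hc N Y hYdisj hYlie' (hr (N + c₃) Y hYcard hYdisj hYlie)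
  -- K4: the ordinary host, the honest point x through ρ_C, dominance, arithmetic weights, classicality
  obtain ⟨Λ, R, _i1, _i2, _i3, _i4, _i5, _i6, _i7, T, x, D, E, S, hxT, hE, hdom, hxint, hDint, hDacc, hS3,
    hclass⟩ := h₄ f hcpt ι e S₀ ρC hgen hin hsc hmod
  -- the maximal ideal 𝔐 of ℤ̄ cut out by ι (landed dictionary)
  obtain ⟨𝔐, h𝔐max, h𝔐3, hdict⟩ := stub_dictionary ι e
  refine ⟨e, 𝔐, S ∪ S₀, h𝔐max, h𝔐3, fun k => ?_⟩
  -- accumulation (landed): a classical point y with ‖y − x‖ ≤ 3^{-k} uniformly on R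
  obtain ⟨y, hyD, hyx⟩ := stub_accumulation Λ R x D E hE hdom hxint hDint hDacc k
  obtain ⟨ρy, hρyT, P, hPreg, hP⟩ := hclass y hyD
  refine ⟨P, hPreg, fun 𝔭 h𝔭 => ?_⟩
  have h𝔭S : 𝔭 ∉ S := fun h => h𝔭 (Finset.mem_union_left _ h)
  have h𝔭S₀ : 𝔭 ∉ S₀ := fun h => h𝔭 (Finset.mem_union_right _ h)
  have h3 : ((3 : ℕ) : 𝓞 K) ∉ 𝔭.asIdeal := fun h => h𝔭S₀ (hin.1 𝔭 h)
  obtain ⟨⟨α, t₀, hα, ht₀⟩, hcomp⟩ := hP 𝔭 h𝔭S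
  have happrox : ∀ g, ‖FramedRep.trace ρy g - FramedRep.trace ρC g‖ ≤ ((3 : ℝ)⁻¹) ^ k := by
    intro g
    rw [hρyT g, ← hxT g]
    exact hyx _
  obtain ⟨t, u, ht, hu, hut⟩ :=
    hdict k f ρC ρy 𝔭 α t₀ h3 (hin.2.2 𝔭 h𝔭S₀) ((hcomp h3) α hα).2 ht₀ happrox
  exact ⟨α, t, u, hα, ht, hu, hut⟩

/-- **The crux from the five remaining registered stubs** (K3 `stub_liePlaces` is landed and used inside `MuOrdinaryFamilyRT_of`). -/
theorem MuOrdinaryFamilyRT_proof : Summit.Langlands.Langlands.Theses.PicardMuOrdinary.MuOrdinaryFamilyRT :=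
  MuOrdinaryFamilyRT_of stub_picardFact stub_modNAutomorphy stub_levelLowering stub_hidaLimitHost stub_remainder

/-! ### Disprover lemmas the statements are checked against (imported from `Theorems/MuOrdinaryFamilyRT/Negative/`) -/

example := @Summit.Langlands.Langlands.Theorems.MuOrdinaryFamilyRT.Negative.stub_accumulation_false_without_dominance
example := @Summit.Langlands.Langlands.Theorems.MuOrdinaryFamilyRT.Negative.stub_accumulation_false_without_normality
example := @Summit.Langlands.Langlands.Theorems.MuOrdinaryFamilyRT.Negative.muOrdinaryFamilyRT_iff_remainder
example := @Summit.Langlands.Langlands.Theorems.MuOrdinaryFamilyRT.Negative.not_cong_two_mul_one_sub_natCast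
example := @Summit.Langlands.Langlands.Theorems.MuOrdinaryFamilyRT.Negative.zariskiDense_not_padicallyDense

end

end Summit.Langlands.Langlands.Cruxes.MuOrdinaryFamilyRT.Mod3nSuccessiveApproximation
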